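import Mathlib
import Summits.MatrixMultiplication.MatrixMultiplication.Theses.SnSubsetDichotomy
import Summits.MatrixMultiplication.MatrixMultiplication.Theorems.SnSubsetDichotomyUmvirateDescent
import Summits.MatrixMultiplication.MatrixMultiplication.Theorems.SnSubsetDichotomyPolynomialSlackStubSplit

/-!
# `SnSubsetDichotomy.JuntaBranch` — same-target PACKING CAPS for umvirate descent

Helper lemmas for crux `stmt-MatrixMultiplication-8304` (`JuntaBranch`), valid for every line that
descends a TPP triple `S, T, U ⊆ S_n` to a common target block `L` (the route's `UmvirateDescent`):
write `X_I := {σ ∈ X | σ ∘ I = L}` for an injective source tuple `I : Fin t → Fin n`.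

* `card_filter_comp_eq_le_factorial` — for injective `J, I : Fin t → Fin n`, the permutations `π`
  with `π ∘ J = I` number at most `(n - t)!` (they form a right translate of the pointwise
  stabiliser of `range I`, which is the image of `Perm (Fin (n - t))`).
* `pairPacking_first`/`_outer`/`_second` — under the triple product property (third set non-empty as
  a witness) the quotient map `(s, τ) ↦ s⁻¹ τ` is injective on `S × T` (tree lemmas
  `PolynomialSlack.injOn_quot_first/second/outer`, file `SnSubsetDichotomyPolynomialSlackStubSplit`)
  and sends `S_I × T_J` into `{π | π ∘ J = I}`, so `|S_I|·|T_J| ≤ (n - t)!`; likewise for the pairs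
  `(S, U)` and `(T, U)`.
* `sameTarget_sq_cap` — `|S_I|²·|T_J|·|U_P| ≤ ((n - t)!)²`, and `sameTarget_cube_cap` —
  `(|S_I|·|T_J|·|U_P|)² ≤ ((n - t)!)³`: every common-target descent lands at or below the packing
  bound of `S_{n-t}`, so its gain in normalised volume is at most `(n!)^{3/2}/(|S||T||U|)`, and a
  super-neutral block of `S` (`|S_I|·n^{(t)} > n^{(1/2+ε)t}|S|`) forces its partners to be
  sub-neutral at the same target (the quantitative why-might-fail of the crux, triage r1 B1/T1).

These caps were first checked in the crux triage (refuter evidence `SameTargetPacking.lean`,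
2026-08-15, not landable by a refuter); this file re-proves them from the tree's
`exists_monoidHom_perm_range_stabilizer` so that provers can import them.
-/

set_option linter.dupNamespace false

open Literature.Combinatorics.Additive
open Summit.MatrixMultiplication.MatrixMultiplication.Theses.SnSubsetDichotomy
open scoped Classical

namespace Summit.MatrixMultiplication.MatrixMultiplication.Theorems.JuntaBranch

/-- The permutations of `Fin n` fixing every `I k` number at most `(n - t)!` when
`I : Fin t → Fin n` is injective: they lie in the range of the injective homomorphism
`Perm (Fin (n - t)) →* Perm (Fin n)` of `exists_monoidHom_perm_range_stabilizer`. [folklore] -/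
theorem card_filter_fix_le_factorial {n t : ℕ} (I : Fin t → Fin n) (hI : Function.Injective I) :
    (Finset.univ.filter (fun π : Equiv.Perm (Fin n) => ∀ k, π (I k) = I k)).card ≤
      (n - t).factorial := by
  obtain ⟨ψ, hψ, hrange⟩ := exists_monoidHom_perm_range_stabilizer I hI
  calc (Finset.univ.filter (fun π : Equiv.Perm (Fin n) => ∀ k, π (I k) = I k)).card
      ≤ (Finset.univ.image ψ).card := by
        refine Finset.card_le_card (fun π hπ => ?_)
        obtain ⟨ρ, hρ⟩ := hrange π (Finset.mem_filter.mp hπ).2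
        exact Finset.mem_image.mpr ⟨ρ, Finset.mem_univ _, hρ⟩
    _ ≤ (Finset.univ : Finset (Equiv.Perm (Fin (n - t)))).card := Finset.card_image_le
    _ = (n - t).factorial := by
        rw [Finset.card_univ, Fintype.card_perm, Fintype.card_fin]

/-- For injective `J, I : Fin t → Fin n`, the permutations `π` with `π (J k) = I k` for all `k`
number at most `(n - t)!`: with `a ∘ I = J` (`Equiv.Perm.exists_extending_pair`) the map
`π ↦ π * a` sends them injectively into the pointwise stabiliser of the `I k`. [folklore] -/
theorem card_filter_comp_eq_le_factorial {n t : ℕ} (J I : Fin t → Fin n)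
    (hJ : Function.Injective J) (hI : Function.Injective I) :
    (Finset.univ.filter (fun π : Equiv.Perm (Fin n) => ∀ k, π (J k) = I k)).card ≤
      (n - t).factorial := by
  obtain ⟨a, ha⟩ := Equiv.Perm.exists_extending_pair I J hI hJ
  refine le_trans ?_ (card_filter_fix_le_factorial I hI)
  refine Finset.card_le_card_of_injOn (fun π => π * a) (fun π hπ => ?_) ?_
  · have hπ' := (Finset.mem_filter.mp (Finset.mem_coe.mp hπ)).2
    refine Finset.mem_coe.mpr (Finset.mem_filter.mpr ⟨Finset.mem_univ _, fun k => ?_⟩)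
    rw [Equiv.Perm.mul_apply, ha, hπ' k]
  · intro π _ π' _ h
    exact mul_right_cancel h


/-- **Pair packing at a common target, abstract form.**  If `(x, y) ↦ x⁻¹ y` is injective on
`A × B ⊆ S_n × S_n`, then for injective `I, J, L : Fin t → Fin n` the atoms
`A_I = {σ ∈ A | σ ∘ I = L}` and `B_J = {τ ∈ B | τ ∘ J = L}` satisfy `|A_I|·|B_J| ≤ (n - t)!`:
the quotient `σ⁻¹ τ` maps `J ↦ L ↦ I`. [folklore] -/
theorem card_atom_mul_le_of_injOn {n t : ℕ} {A B : Finset (Equiv.Perm (Fin n))}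
    (hinj : Set.InjOn (fun x : Equiv.Perm (Fin n) × Equiv.Perm (Fin n) => x.1⁻¹ * x.2)
      (↑A ×ˢ ↑B : Set (Equiv.Perm (Fin n) × Equiv.Perm (Fin n))))
    (I J L : Fin t → Fin n) (hI : Function.Injective I) (hJ : Function.Injective J) :
    (A.filter (fun σ => ∀ k, σ (I k) = L k)).card * (B.filter (fun σ => ∀ k, σ (J k) = L k)).card
      ≤ (n - t).factorial := by
  rw [← Finset.card_product]
  refine le_trans ?_ (card_filter_comp_eq_le_factorial J I hJ hI)
  refine Finset.card_le_card_of_injOn (fun x => x.1⁻¹ * x.2) (fun x hx => ?_) (fun x hx y hy hxy => ?_)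
  · obtain ⟨h1, h2⟩ := Finset.mem_product.mp (Finset.mem_coe.mp hx)
    obtain ⟨-, hσ⟩ := Finset.mem_filter.mp h1
    obtain ⟨-, hτ⟩ := Finset.mem_filter.mp h2
    refine Finset.mem_coe.mpr (Finset.mem_filter.mpr ⟨Finset.mem_univ _, fun k => ?_⟩)
    rw [Equiv.Perm.mul_apply, hτ k, Equiv.Perm.inv_eq_iff_eq, hσ k]
  · refine hinj ?_ ?_ hxy
    · obtain ⟨h1, h2⟩ := Finset.mem_product.mp (Finset.mem_coe.mp hx)
      exact Set.mk_mem_prod (Finset.mem_coe.mpr (Finset.mem_filter.mp h1).1)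
        (Finset.mem_coe.mpr (Finset.mem_filter.mp h2).1)
    · obtain ⟨h1, h2⟩ := Finset.mem_product.mp (Finset.mem_coe.mp hy)
      exact Set.mk_mem_prod (Finset.mem_coe.mpr (Finset.mem_filter.mp h1).1)
        (Finset.mem_coe.mpr (Finset.mem_filter.mp h2).1)

variable {n t : ℕ} {S T U : Finset (Equiv.Perm (Fin n))}

/-- **Pair packing at a common target** (triage B1/T1): for a TPP triple with `U ≠ ∅` and
injective `I, J, L`, `|S ∩ U_{I→L}|·|T ∩ U_{J→L}| ≤ (n - t)!`. [folklore] -/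
theorem pairPacking_first (h : TripleProductProperty S T U) (hU : U.Nonempty)
    (I J L : Fin t → Fin n) (hI : Function.Injective I) (hJ : Function.Injective J) :
    (S.filter (fun σ => ∀ k, σ (I k) = L k)).card * (T.filter (fun σ => ∀ k, σ (J k) = L k)).card
      ≤ (n - t).factorial :=
  card_atom_mul_le_of_injOn (PolynomialSlack.injOn_quot_first h hU) I J L hI hJ

/-- Pair packing at a common target for the outer pair `(S, U)` (witness in `T`). [folklore] -/
theorem pairPacking_outer (h : TripleProductProperty S T U) (hT : T.Nonempty)
    (I P L : Fin t → Fin n) (hI : Function.Injective I) (hP : Function.Injective P) :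
    (S.filter (fun σ => ∀ k, σ (I k) = L k)).card * (U.filter (fun σ => ∀ k, σ (P k) = L k)).card
      ≤ (n - t).factorial :=
  card_atom_mul_le_of_injOn (PolynomialSlack.injOn_quot_outer h hT) I P L hI hP

/-- Pair packing at a common target for the pair `(T, U)` (witness in `S`). [folklore] -/
theorem pairPacking_second (h : TripleProductProperty S T U) (hS : S.Nonempty)
    (J P L : Fin t → Fin n) (hJ : Function.Injective J) (hP : Function.Injective P) :
    (T.filter (fun σ => ∀ k, σ (J k) = L k)).card * (U.filter (fun σ => ∀ k, σ (P k) = L k)).card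
      ≤ (n - t).factorial :=
  card_atom_mul_le_of_injOn (PolynomialSlack.injOn_quot_second h hS) J P L hJ hP

/-- **Same-target square cap** (triage B1): for a TPP triple with `T, U ≠ ∅` and injective
`I, J, P, L`, `|S_I|²·|T_J|·|U_P| ≤ ((n - t)!)²`.  Consequently a descent through an
`ε`-super-neutral block of `S` in a `Large` triple gains `< e^{2c√n}·n^{-εt}`. [folklore] -/
theorem sameTarget_sq_cap (h : TripleProductProperty S T U) (hT : T.Nonempty) (hU : U.Nonempty)
    (I J P L : Fin t → Fin n) (hI : Function.Injective I) (hJ : Function.Injective J)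
    (hP : Function.Injective P) :
    (S.filter (fun σ => ∀ k, σ (I k) = L k)).card ^ 2 *
        (T.filter (fun σ => ∀ k, σ (J k) = L k)).card *
        (U.filter (fun σ => ∀ k, σ (P k) = L k)).card ≤ (n - t).factorial ^ 2 := by
  have h1 := pairPacking_first h hU I J L hI hJ
  have h2 := pairPacking_outer h hT I P L hI hP
  calc _ = ((S.filter (fun σ => ∀ k, σ (I k) = L k)).card *
        (T.filter (fun σ => ∀ k, σ (J k) = L k)).card) *
        ((S.filter (fun σ => ∀ k, σ (I k) = L k)).card *
        (U.filter (fun σ => ∀ k, σ (P k) = L k)).card) := by ring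
    _ ≤ (n - t).factorial * (n - t).factorial := Nat.mul_le_mul h1 h2
    _ = (n - t).factorial ^ 2 := by ring

/-- **Same-target cube cap** (triage B1): for a TPP triple with all three sets non-empty and
injective `I, J, P` (any common target `L`), `(|S_I|·|T_J|·|U_P|)² ≤ ((n - t)!)³` — every
common-target umvirate descent lands at or below the packing bound `((n-t)!)^{3/2}` of `S_{n-t}`,
so its gain in normalised volume is at most `(n!)^{3/2}/(|S||T||U|)` (`≤ e^{c√n}` for a `Large`
triple).  Registered on the crux as sub-goal `sameTarget_cube_cap`. [folklore] -/
theorem sameTarget_cube_cap :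
    ∀ (n t : ℕ) (S T U : Finset (Equiv.Perm (Fin n))), TripleProductProperty S T U →
      S.Nonempty → T.Nonempty → U.Nonempty → ∀ I J P L : Fin t → Fin n,
      Function.Injective I → Function.Injective J → Function.Injective P →
      ((S.filter (fun σ => ∀ k, σ (I k) = L k)).card *
          (T.filter (fun σ => ∀ k, σ (J k) = L k)).card *
          (U.filter (fun σ => ∀ k, σ (P k) = L k)).card) ^ 2 ≤ (n - t).factorial ^ 3 := by
  intro n t S T U h hS hT hU I J P L hI hJ hP
  have h1 := pairPacking_first h hU I J L hI hJ
  have h2 := pairPacking_outer h hT I P L hI hP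
  have h3 := pairPacking_second h hS J P L hJ hP
  calc _ = ((S.filter (fun σ => ∀ k, σ (I k) = L k)).card *
        (T.filter (fun σ => ∀ k, σ (J k) = L k)).card) *
        (((S.filter (fun σ => ∀ k, σ (I k) = L k)).card *
        (U.filter (fun σ => ∀ k, σ (P k) = L k)).card) *
        ((T.filter (fun σ => ∀ k, σ (J k) = L k)).card *
        (U.filter (fun σ => ∀ k, σ (P k) = L k)).card)) := by ring
    _ ≤ (n - t).factorial * ((n - t).factorial * (n - t).factorial) :=
        Nat.mul_le_mul h1 (Nat.mul_le_mul h2 h3)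
    _ = (n - t).factorial ^ 3 := by ring

end Summit.MatrixMultiplication.MatrixMultiplication.Theorems.JuntaBranch
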